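import Summits.SmoothPoincare4.SmoothPoincare4.Theorems.DottedCircleRasmussenDcrGapHelperFriendsCarrierTkAux13

/-!
# Helper `helper_friendsCarrier_Tk_endSmoothCollarInv` of stub `helper_friendsCarrier_Tk` — the end collar, part 7: the inverse collar is smooth
(item stmt-SmoothPoincare4-16128, route route-SmoothPoincare4-DottedCircleRasmussen)

Continuation of `…TkAux8–13` (end collar, parts 1–6), porting the second half of the section
*Smoothness of the inverse collar* of the tree's `OpenTraceCollar.lean`: the open cover of `T ∖ C` by
the tube region (drops in the open tube off the knot), the radial region (drops off the closed tube)
and the flat region of the handle chart, on which `collarInv` is `ΨTube ∘ πl`, `ΨRad ∘ πl`,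
`ΨFlat ∘ πr`; hence **`collarInv` is `C^∞` on `T ∖ C`**, and the collar is an open partial
homeomorphism `collarPH : Y × ℝ ≅ T ∖ C`, smooth with smooth inverse.

* `EndDatum.SmoothPresentation.contMDiffOn_collarInv`, `collarPH`, `isOpen_image_collar`;
* `helper_friendsCarrier_Tk_endSmoothCollarInv` — the registered summary.

Everything is proved; no named facts, no `sorry`.
References: Kirby (1989), Ch. I §5 [Kirby1989]; the tree's `OpenTraceCollar.lean`.
-/

-- the prescribed namespace `Summit.<P>.<Sub>.…` duplicates `SmoothPoincare4` (P = Sub)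
set_option linter.dupNamespace false
set_option linter.style.longLine false

noncomputable section

open scoped Manifold ContDiff Topology
open Function Set Metric
open Literature.Topology.FourManifolds Literature.Topology.FourManifolds.MMSW

namespace Summit.SmoothPoincare4.SmoothPoincare4.Theorems.DcrGap.MkFriends

namespace FriendsTk

namespace EndDatum

variable {k : ℕ} (E : EndDatum k)

/-! ### Monotonicity of the radius/time exchange -/

/-- `s(·)` is strictly decreasing on `[0, ∞)`: `s α < s β ↔ β < α`. [folklore] -/
theorem collarTime_lt_collarTime_iff {α β : ℝ} (hα : 0 ≤ α) (hβ : 0 ≤ β) : E.collarTime α < E.collarTime β ↔ β < α := by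
  have hδ := E.δ_pos
  simp only [TraceDatum.collarTime]
  rw [div_lt_div_iff₀ (by linarith) (by linarith)]
  constructor
  · intro h; nlinarith
  · intro h; nlinarith

/-- `s α ≤ s β ↔ β ≤ α` on `[0, ∞)`. [folklore] -/
theorem collarTime_le_collarTime_iff {α β : ℝ} (hα : 0 ≤ α) (hβ : 0 ≤ β) : E.collarTime α ≤ E.collarTime β ↔ β ≤ α := by
  rw [← not_lt, E.collarTime_lt_collarTime_iff hβ hα, not_lt]

/-- For a band point off `D_k`, `s(α) = G_k y - 1` with `α` its handle radius. [folklore] -/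
theorem collarTime_radA {y : EuclideanSpace ℝ (Fin 4)} (hy : y ∈ E.hbNbhd) (h1 : 1 < levelFun k y) :
    E.collarTime (E.radA y) = levelFun k y - 1 :=
  E.collarTime_handleRadius ⟨by linarith [E.δ_pos], by linarith [hy.2]⟩

/-! ### The regions of the trace off the core -/

/-- The open band `{y ∈ P | G_k y > 1}` of the `0`-handle side. [folklore] -/
theorem isOpen_band : IsOpen {y : EuclideanSpace ℝ (Fin 4) | y ∈ E.hbNbhd ∧ 1 < levelFun k y} :=
  ((continuousOn_levelFun (r := k) (by norm_num : (0 : ℝ) < 1 / 2)).mono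
    (fun y (hy : y ∈ E.hbNbhd) j => le_of_lt (hy.1 j))).isOpen_inter_preimage E.isOpen_hbNbhd isOpen_Ioi

/-- The drop is continuous on `P`. [folklore] -/
theorem continuousOn_dropA : ContinuousOn E.dropA E.hbNbhd := fun _ hy => (E.contDiffAt_dropA hy).continuousAt.continuousWithinAt

/-- The open tube off the knot, thickened along the collar: `{y ∈ flowTube₀ | (ι₀ y).2 ≠ 0}`. [folklore] -/
theorem isOpen_thickTube : IsOpen {y : EuclideanSpace ℝ (Fin 4) | y ∈ {y : EuclideanSpace ℝ (Fin 4) |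
    (∀ j, (1 : ℝ) / 2 < holeTerm k j y) ∧ levelFun k y ∈ Ioo (1 - E.δ) (1 + E.δ) ∧ E.θ (1 - levelFun k y, y) ∈ range E.ν₀} ∧
      (E.ι₀ y).2 ≠ 0} :=
  (continuous_snd.comp_continuousOn E.contMDiffOn_ι₀.continuousOn).isOpen_inter_preimage E.isOpen_flowTube₀ isOpen_ne

/-- The tube region of the trace: `incl` of band points whose drop is in the open tube off the knot. [folklore] -/
def tubeSetT : Set E.Trace :=
  E.incl '' {y | (y ∈ E.hbNbhd ∧ 1 < levelFun k y) ∧ E.dropA y ∈ {y : EuclideanSpace ℝ (Fin 4) | y ∈ {y : EuclideanSpace ℝ (Fin 4) |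
    (∀ j, (1 : ℝ) / 2 < holeTerm k j y) ∧ levelFun k y ∈ Ioo (1 - E.δ) (1 + E.δ) ∧ E.θ (1 - levelFun k y, y) ∈ range E.ν₀} ∧
      (E.ι₀ y).2 ≠ 0}}

/-- The tube region of the trace is open. [folklore] -/
theorem isOpen_tubeSetT : IsOpen E.tubeSetT :=
  E.isOpen_image_incl (fun _ hy => hy.1.1)
    ((E.continuousOn_dropA.mono fun _ hy => hy.1).isOpen_inter_preimage E.isOpen_band E.isOpen_thickTube)

/-- The radial region of the trace is open. [folklore] -/
theorem isOpen_radSetT : IsOpen E.radSetT := by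
  have heq : E.radSetT = E.incl '' ({y | y ∈ E.hbNbhd ∧ 1 < levelFun k y} ∩ E.dropA ⁻¹' (E.closedTube)ᶜ) := by
    rw [radSetT]; congr 1; ext y; simp only [mem_setOf_eq, mem_inter_iff, mem_preimage, mem_compl_iff, and_assoc]
  rw [heq]
  exact E.isOpen_image_incl (fun _ hy => hy.1.1)
    ((E.continuousOn_dropA.mono fun _ hy => hy.1).isOpen_inter_preimage E.isOpen_band E.isCompact_closedTube.isClosed.isOpen_compl)

/-- On the tube region the inverse collar is the tube inverse formula. [folklore] -/
theorem collarInv_eq_ΨTube_of_mem {Y : Type*} (jM : EuclideanSpace ℝ (Fin 4) → Y) (jB : ↥solidTorus → Y)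
    {y : EuclideanSpace ℝ (Fin 4)} (hy : y ∈ E.hbNbhd) (h1 : 1 < levelFun k y) (h : E.dropA y ∈ range E.ν₀) :
    E.ΨTube jM y = E.collarInv jM jB (E.incl y) := by
  symm
  by_cases hc : E.dropA y ∈ E.closedTube
  · exact E.collarInv_incl_of_mem jM jB hy hc
  · rw [E.collarInv_incl_of_not_mem jM jB hy h1 hc]
    obtain ⟨⟨u, w⟩, hq⟩ := h
    have hw : 2 ≤ ‖w‖ := by
      by_contra h'
      exact hc (hq ▸ (E.mem_closedTube_iff).2 (not_le.1 h').le)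
    obtain ⟨hα, hα1⟩ := E.radA_mem_Ioo hy h1
    exact E.ΨRad_eq_ΨTube jM hα hα1 hw hq.symm

namespace Presentation

variable {E} {Y : Type*} [TopologicalSpace Y] [ChartedSpace (EuclideanSpace ℝ (Fin 3)) Y] (P : E.Presentation Y)

/-- On the flat region the inverse collar is the flat inverse formula. [folklore] -/
theorem collarInv_eq_ΨFlat_of_mem {z : EuclideanSpace ℝ (Fin 2) × EuclideanSpace ℝ (Fin 2)} (hz : z ∈ TubeNbhd.flatSetT) :
    E.collarInv P.jM P.jB (E.trGlueData.inr z) = TubeNbhd.ΨFlat P.jB z := by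
  obtain ⟨x, w⟩ := z
  obtain ⟨hx1, hw, hflat⟩ := hz
  simp only at hx1 hw hflat
  by_cases hx : x = 0
  · subst hx; exact E.collarInv_inr_zero P.jM P.jB w
  · have hx0 : (x, w).1 ≠ 0 := hx
    have hxpos : 0 < ‖x‖ := norm_pos_iff.2 hx
    have hy : E.bwd (x, w) = E.θ (E.collarTime ‖x‖, E.ν₀ (radialProjection (spherePt 1) x,
        OpenPartialHomeomorph.univBall (0 : EuclideanSpace ℝ (Fin 2)) 2 w)) := by
      conv_lhs => rw [← norm_smul_coe_radialProjection (spherePt 1) x]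
      rw [E.bwd_smul hxpos, E.νK_eq]
    obtain ⟨hdrop, -, -⟩ := E.dropA_radA_ptA_arg (E.ν₀_mem (radialProjection (spherePt 1) x,
      OpenPartialHomeomorph.univBall (0 : EuclideanSpace ℝ (Fin 2)) 2 w)) hxpos
    have hmem : E.dropA (E.bwd (x, w)) ∈ E.closedTube := by
      rw [hy, hdrop, mem_closedTube_iff]; exact (TubeNbhd.norm_univBall_lt w).le
    rw [E.inr_eq_incl_bwd hx0, E.collarInv_incl_of_mem P.jM P.jB (E.bwd_mem_hbNbhd hx0) hmem]
    exact P.ΨTube_eq_ΨFlat hx hx1 hw hflat.le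

end Presentation

namespace SmoothPresentation

variable {E} {Y : Type*} [TopologicalSpace Y] [ChartedSpace (EuclideanSpace ℝ (Fin 3)) Y] (P : E.SmoothPresentation Y)

/-- **The inverse collar is smooth off the core.** [folklore] -/
theorem contMDiffOn_collarInv : ContMDiffOn (𝓡 4) ((𝓡 3).prod 𝓘(ℝ, ℝ)) ∞ (E.collarInv P.jM P.jB) (E.trCore)ᶜ := by
  intro z hz
  refine ContMDiffAt.contMDiffWithinAt ?_
  rcases E.exists_of_not_mem_trCore hz with ⟨y, hy, h1, h2, rfl⟩ | ⟨w, hw, rfl⟩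
  · obtain ⟨hα, hα1, hdropM, hrange, -⟩ := E.offCore_coords hy h1 h2
    have hinvAt : ContMDiffAt (𝓡 4) (𝓡 4) ∞ E.πl (E.incl y) :=
      E.contMDiffOn_πl.contMDiffAt (by rw [← E.image_incl_hbNbhd]; exact (E.isOpen_image_incl subset_rfl E.isOpen_hbNbhd).mem_nhds ⟨y, hy, rfl⟩)
    by_cases hc : E.dropA y ∈ E.closedTube
    · -- tube region: `collarInv = ΨTube ∘ πl`
      obtain ⟨⟨u, w⟩, -, hq⟩ := hc
      have hw : w ≠ 0 := fun h0 => hrange (by rw [← hq, h0]; exact E.ν₀_mem_range_iff.2 rfl)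
      have hν : E.dropA y ∈ range E.ν₀ := ⟨_, hq⟩
      have hι : (E.ι₀ (E.dropA y)).2 ≠ 0 := by rw [← hq, E.ι₀_ν₀]; exact hw
      have hmemT : E.incl y ∈ E.tubeSetT := ⟨y, ⟨⟨hy, h1⟩, (E.mem_flowTube₀_iff_of_mem hdropM).2 hν, hι⟩, rfl⟩
      have hev : E.collarInv P.jM P.jB =ᶠ[𝓝 (E.incl y)] fun z => E.ΨTube P.jM (E.πl z) := by
        filter_upwards [E.isOpen_tubeSetT.mem_nhds hmemT] with z hz
        obtain ⟨y', ⟨⟨hy', h1'⟩, hmem', -⟩, rfl⟩ := hz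
        rw [E.πl_incl hy']
        exact (E.collarInv_eq_ΨTube_of_mem P.jM P.jB hy' h1' ((E.mem_flowTube₀_iff_of_mem (E.dropA_mem hy' h1').1).1 hmem')).symm
      refine ContMDiffAt.congr_of_eventuallyEq ?_ hev
      have hΨ := P.contMDiffAt_ΨTube hy h1 hν hι
      rw [← E.πl_incl hy] at hΨ
      exact ContMDiffAt.comp (g := E.ΨTube P.jM) (f := E.πl) _ hΨ hinvAt
    · -- radial region: `collarInv = ΨRad ∘ πl`
      have hmemR : E.incl y ∈ E.radSetT := ⟨y, ⟨hy, h1, hc⟩, rfl⟩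
      have hev : E.collarInv P.jM P.jB =ᶠ[𝓝 (E.incl y)] fun z => E.ΨRad P.jM (E.πl z) := by
        filter_upwards [E.isOpen_radSetT.mem_nhds hmemR] with z hz
        obtain ⟨y', ⟨hy', h1', h'⟩, rfl⟩ := hz
        rw [E.πl_incl hy']; exact E.collarInv_incl_of_not_mem P.jM P.jB hy' h1' h'
      refine ContMDiffAt.congr_of_eventuallyEq ?_ hev
      have hΨ := P.contMDiffAt_ΨRad hy h1 hrange
      rw [← E.πl_incl hy] at hΨ
      exact ContMDiffAt.comp (g := E.ΨRad P.jM) (f := E.πl) _ hΨ hinvAt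
  · -- flat region: `collarInv = ΨFlat ∘ πr`
    have hmemF : ((0 : EuclideanSpace ℝ (Fin 2)), w) ∈ TubeNbhd.flatSetT := by
      refine ⟨by simp, hw, ?_⟩
      simp only [norm_zero]
      rw [show TraceCollar.ξ 0 = 0 by simp [TraceCollar.ξ], mul_zero]
      have hr : 0 < ‖OpenPartialHomeomorph.univBall (0 : EuclideanSpace ℝ (Fin 2)) 2 w‖ := norm_pos_iff.2 (TubeNbhd.univBall_ne_zero hw)
      exact TraceCollar.ψ_pos (Real.log_pos ((lt_div_iff₀ hr).2 (by linarith [TubeNbhd.norm_univBall_lt w])))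
    have hinvAt : ContMDiffAt (𝓡 4) 𝓘(ℝ, EuclideanSpace ℝ (Fin 2) × EuclideanSpace ℝ (Fin 2)) ∞ E.πr (E.trGlueData.inr (0, w)) :=
      E.contMDiffOn_πr.contMDiffAt (E.trGlueData.isOpen_range_inr.mem_nhds (mem_range_self _))
    have hev : E.collarInv P.jM P.jB =ᶠ[𝓝 (E.trGlueData.inr (0, w))] fun z => TubeNbhd.ΨFlat P.jB (E.πr z) := by
      filter_upwards [(E.trGlueData.isOpenEmbedding_inr.isOpenMap _ TubeNbhd.isOpen_flatSetT).mem_nhds ⟨_, hmemF, rfl⟩] with z hz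
      obtain ⟨z', hz', rfl⟩ := hz
      rw [E.πr_inr]; exact P.collarInv_eq_ΨFlat_of_mem hz'
    refine ContMDiffAt.congr_of_eventuallyEq ?_ hev
    have hΨ := P.contMDiffAt_ΨFlat hmemF
    rw [← E.πr_inr ((0 : EuclideanSpace ℝ (Fin 2)), w)] at hΨ
    exact ContMDiffAt.comp (g := TubeNbhd.ΨFlat P.jB) (f := E.πr) _ hΨ hinvAt

/-- **The collar as an open partial homeomorphism** `Y × ℝ ≅ T ∖ C`. [folklore] -/
def collarPH : OpenPartialHomeomorph (Y × ℝ) E.Trace where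
  toFun := E.collar P.jM P.jB P.ψ
  invFun := E.collarInv P.jM P.jB
  source := univ
  target := (E.trCore)ᶜ
  map_source' p _ := P.collar_not_mem_trCore p
  map_target' _ _ := mem_univ _
  left_inv' p _ := P.collarInv_collar p
  right_inv' _ hz := P.collar_collarInv hz
  open_source := isOpen_univ
  open_target := E.isClosed_trCore.isOpen_compl
  continuousOn_toFun := P.contMDiff_collar.continuous.continuousOn
  continuousOn_invFun := P.contMDiffOn_collarInv.continuousOn

/-- The collar partial homeomorphism as a function. [folklore] -/
theorem collarPH_apply (p : Y × ℝ) : P.collarPH p = E.collar P.jM P.jB P.ψ p := rfl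

/-- The collar is an open map. [folklore] -/
theorem isOpen_image_collar {s : Set (Y × ℝ)} (hs : IsOpen s) : IsOpen (E.collar P.jM P.jB P.ψ '' s) :=
  P.collarPH.isOpen_image_of_subset_source hs (subset_univ _)

end SmoothPresentation

end EndDatum

end FriendsTk

/-- **Helper `helper_friendsCarrier_Tk_endSmoothCollarInv`** (registered on the crux item; end collar part 7
of stub `helper_friendsCarrier_Tk`): under the hypotheses of `helper_friendsCarrier_Tk`, the end collar of
the relative open trace is an open partial homeomorphism `c : Y × ℝ ≅ T ∖ C` defined on all of `Y × ℝ`,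
`C^∞` with `C^∞` inverse, onto the complement of the compact core (Kirby 1989, Ch. I §5). [cite: Kirby1989, Ch. I §5] -/
theorem helper_friendsCarrier_Tk_endSmoothCollarInv : ∀ (k : ℕ) (K₀ : (sphere (0 : EuclideanSpace ℝ (Fin 2)) 1) → EuclideanSpace ℝ (Fin 4)), IsModelKnot k K₀ → ∀ (Y : Type) [TopologicalSpace Y] [T2Space Y] [SecondCountableTopology Y] [ChartedSpace (EuclideanSpace ℝ (Fin 3)) Y] [IsManifold (𝓡 3) ∞ Y] (jB : solidTorus → Y) (μ₀ : C((sphere (0 : EuclideanSpace ℝ (Fin 2)) 1), Y)) (νK : (sphere (0 : EuclideanSpace ℝ (Fin 2)) 1) × EuclideanSpace ℝ (Fin 2) → EuclideanSpace ℝ (Fin 4)) (jM : EuclideanSpace ℝ (Fin 4) → Y) (W : Set (EuclideanSpace ℝ (Fin 4))) (ψ : Y → EuclideanSpace ℝ (Fin 4)), (Manifold.IsSmoothEmbedding (𝓘(ℝ, EuclideanSpace ℝ (Fin 2)).prod (𝓡 1)) (𝓡 3) ∞ jB ∧ IsOpen (range jB) ∧ ContMDiff ((𝓡 1).prod 𝓘(ℝ,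 EuclideanSpace ℝ (Fin 2))) 𝓘(ℝ, EuclideanSpace ℝ (Fin 4)) ∞ νK ∧ Injective νK ∧ (∀ p, Injective (mfderiv ((𝓡 1).prod 𝓘(ℝ, EuclideanSpace ℝ (Fin 2))) 𝓘(ℝ, EuclideanSpace ℝ (Fin 4)) νK p)) ∧ (∀ p, νK p ∈ modelBoundary k) ∧ (∀ u : (sphere (0 : EuclideanSpace ℝ (Fin 2)) 1), νK (u, 0) = K₀ u) ∧ IsOpen W ∧ (∀ x ∈ modelBoundary k, x ∉ range K₀ → x ∈ W) ∧ ContMDiffOn 𝓘(ℝ, EuclideanSpace ℝ (Fin 4)) (𝓡 3) ∞ jM W ∧ IsOpen (jM '' {x : EuclideanSpace ℝ (Fin 4) | x ∈ modelBoundary k ∧ x ∉ range K₀}) ∧ ContMDiffOn (𝓡 3) 𝓘(ℝ, EuclideanSpace ℝ (Fin 4)) ∞ ψ (jM '' {x : EuclideanSpace ℝ (Fin 4) | x ∈ modelBoundary k ∧ x ∉ range K₀}) ∧ (∀ x ∈ modelBoundary k, x ∉ range K₀ → ψ (jM x) = x) ∧ jM '' {x : EuclideanSpace ℝ (Fin 4)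 | x ∈ modelBoundary k ∧ x ∉ range K₀} ∪ range jB = univ ∧ (∀ x ∈ modelBoundary k, x ∉ range K₀ → ∀ b : solidTorus, jM x = jB b ↔ ∃ (u : (sphere (0 : EuclideanSpace ℝ (Fin 2)) 1)) (t : ℝ), t ∈ Ioo (0 : ℝ) 1 ∧ b.1.1 = t • (u : EuclideanSpace ℝ (Fin 2)) ∧ x = νK (u, t • (b.1.2 : EuclideanSpace ℝ (Fin 2))))) → ∃ (X : Type) (_ : TopologicalSpace X) (_ : T2Space X) (_ : ChartedSpace (EuclideanSpace ℝ (Fin 4)) X) (_ : IsManifold (𝓡 4) ∞ X) (c : OpenPartialHomeomorph (Y × ℝ) X), c.source = univ ∧ ContMDiffOn ((𝓡 3).prod 𝓘(ℝ, ℝ)) (𝓡 4) ∞ c c.source ∧ ContMDiffOn (𝓡 4) ((𝓡 3).prod 𝓘(ℝ, ℝ)) ∞ c.symm c.target ∧ IsCompact c.targetᶜ := by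
  intro k K₀ _ Y _ _ _ _ _ jB μ₀ νK jM W ψ ⟨h1, h2, h3, h4, h5, h6, h7, h8, h9, h10, h11, h12, h13, h14, h15⟩
  let E : FriendsTk.EndDatum k := FriendsTk.EndDatum.endDatumOf h3 h4 h5 h6 h7
  let P : E.SmoothPresentation Y := FriendsTk.EndDatum.smoothPresentationOf h3 h4 h5 h6 h7 h1 h2 h8 h9 h10 h11 h12 h13 h14 h15
  exact ⟨E.Trace, inferInstance, inferInstance, inferInstance, inferInstance, P.collarPH, rfl, P.contMDiff_collar.contMDiffOn,
    P.contMDiffOn_collarInv, by rw [show P.collarPH.targetᶜ = E.trCore by simp [FriendsTk.EndDatum.SmoothPresentation.collarPH]]; exact E.isCompact_trCore⟩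

end Summit.SmoothPoincare4.SmoothPoincare4.Theorems.DcrGap.MkFriends

end
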